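import Summits.QuantumAdvantage.AdviceFreeQNC0.RingWindowLocalLt3Proof
import Summits.QuantumAdvantage.AdviceFreeQNC0.TwistBoundX3LocalQuant
import HarnessLib

/-!
# Cell qa-qnc0, `p = 3` — the polylog-radius rung `RingLinFormsLocalPolyLt3` (the JOIN of R-lin3 and R-loc) PROVED

Planner qa-qnc0-p1 g20 (`exp20/Sketch20x.lean` §8, typed VERBATIM in `BondTwistLocal.lean` §8):

* `ringLinFormsLocalPolyLt3_of : TwistBoundX3LocalQ → RingWindowLocalPolyLt3 → RingLinFormsLocalPolyLt3` — the glue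
  (junta/spread dichotomy `LinForms.card_le_junta_add_twist`, template `RingLinFormsLocalGlue.ringLinFormsLocalLt3_of`
  of the constant-radius rung), with POLYLOG bookkeeping: spread threshold `w = 4r + (2r+1)³·T + 1`, `T = T_c·(K + r + 1)`,
  `c·T_c ≥ 65 + m` (so that `3^K e^{−2K} ≤ 1`, `64^r e^{−63 r} ≤ 1`, `A e^{−m} ≤ ε/4`), junta `|J| ≤ K(w−1) ≤ W_b·(log₂N)^{5C}`,
  a junta-free letter window of length `L = N / ((W_b+1)(log₂N)^{5C})` (pigeonhole `exists_window_disjoint_len`) on which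
  the windowed main term is invoked with exponent `5C + 1`;
* **`ringLinFormsLocalPolyLt3 : RingLinFormsLocalPolyLt3`** — bells = per-cut tables of `K ≤ (log₂N)^C` linear forms of
  the letters mod 3 AND the radius-`r` window at the cut, `r ≤ (log₂N)^C`, arbitrary tables, win on `≤ θ·2^{N−1}` odd-class
  patterns, ONE `θ < 1` for all `C` — from `twistBoundX3LocalQ` (g22, `TwistBoundX3LocalQuant.lean`) and
  `ringWindowLocalPolyLt3` (g23, `RingWindowLocalLt3Proof.lean`).

WHAT THIS IS NOT: `θ` is the unoptimised cross-cell constant; the dense non-local residual (crux 22907) is untouched; no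
separation.
-/

noncomputable section

namespace Summit.QuantumAdvantage.AdviceFreeQNC0

open Finset Literature.Computability.QuantumComplexity Literature.Computability.QuantumComplexity.RingHLF
open Literature.Computability.MetaComplexity

namespace BondTwist3

open scoped Classical in
/-- Sign and shape normalisation of the quantitative twist bound: WLOG `0 ≤ A` (replace `A` by `max A 0`), and the bound is
MONOTONE in the support size — for `#supp γ ≥ 4r + (2r+1)³·T` the decay factor is `≤ exp(−c·T)`. -/
theorem twistQ_params (hT : TwistBoundX3LocalQ) : ∃ A c : ℝ, 0 ≤ A ∧ 0 < c ∧
    ∀ (r T N : ℕ) (t : Fin N → (Fin N → Bool) → Bool), IsLocalRule N r t → ∀ γ : Fin N → ZMod 3,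
      4 * r + (2 * r + 1) ^ 3 * T ≤ (univ.filter fun i : Fin N => γ i ≠ 0).card →
      ‖∑ x : Fin N → Bool,
          (ZMod.stdAddChar (∑ i : Fin N, if x i then γ i else 0) : ℂ) *
            (if (OddZeros x ∧ RingHLF.Rel x (fun k => xor (tGuess x k) (t k x))) then (1 : ℂ) else 0)‖
        ≤ A * (64 : ℝ) ^ r * Real.exp (-(c * T)) * (2 : ℝ) ^ N := by
  classical
  obtain ⟨A, c, hc, h⟩ := hT
  refine ⟨max A 0, c, le_max_right _ _, hc, fun r T N t ht γ hs => (h r N t ht γ).trans ?_⟩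
  set s := (univ.filter fun i : Fin N => γ i ≠ 0).card with hsdef
  have hR : (0 : ℝ) < (2 * (r : ℝ) + 1) ^ 3 := by positivity
  have hmono : Real.exp (-(c * ((s : ℝ) - 4 * r) / (2 * (r : ℝ) + 1) ^ 3)) ≤ Real.exp (-(c * T)) := by
    rw [Real.exp_le_exp]
    have h1 : ((4 * r + (2 * r + 1) ^ 3 * T : ℕ) : ℝ) ≤ s := by exact_mod_cast hs
    push_cast at h1
    have h2 : c * (T : ℝ) ≤ c * ((s : ℝ) - 4 * r) / (2 * (r : ℝ) + 1) ^ 3 := by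
      rw [le_div_iff₀ hR]
      have h3 : (T : ℝ) * (2 * (r : ℝ) + 1) ^ 3 ≤ (s : ℝ) - 4 * r := by nlinarith
      calc c * (T : ℝ) * (2 * (r : ℝ) + 1) ^ 3 = c * ((T : ℝ) * (2 * (r : ℝ) + 1) ^ 3) := by ring
        _ ≤ c * ((s : ℝ) - 4 * r) := mul_le_mul_of_nonneg_left h3 hc.le
    have e : c * ((s : ℝ) - 4 * r) / (2 * (r : ℝ) + 1) ^ 3 = (c * ((s : ℝ) - 4 * r)) / (2 * (r : ℝ) + 1) ^ 3 := rfl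
    linarith
  calc A * (64 : ℝ) ^ r * Real.exp (-(c * ((s : ℝ) - 4 * r) / (2 * (r : ℝ) + 1) ^ 3)) * (2 : ℝ) ^ N
      ≤ (max A 0) * (64 : ℝ) ^ r * Real.exp (-(c * ((s : ℝ) - 4 * r) / (2 * (r : ℝ) + 1) ^ 3)) * (2 : ℝ) ^ N := by
        gcongr; exact le_max_left _ _
    _ ≤ (max A 0) * (64 : ℝ) ^ r * Real.exp (-(c * T)) * (2 : ℝ) ^ N := by gcongr

/-- The numerical heart of the error term: `3^K · 64^r · e^{−(2K + 63r)} ≤ 1`. -/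
private theorem three_pow_mul_exp_le (K r : ℕ) :
    (3 : ℝ) ^ K * (64 : ℝ) ^ r * (Real.exp (-2) ^ K * Real.exp (-63) ^ r) ≤ 1 := by
  have h3 : (3 : ℝ) * Real.exp (-2) ≤ 1 := by
    have := Real.add_one_le_exp (2 : ℝ)
    rw [Real.exp_neg, ← div_eq_mul_inv, div_le_one (Real.exp_pos _)]
    linarith
  have h64 : (64 : ℝ) * Real.exp (-63) ≤ 1 := by
    have := Real.add_one_le_exp (63 : ℝ)
    rw [Real.exp_neg, ← div_eq_mul_inv, div_le_one (Real.exp_pos _)]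
    linarith
  have e : (3 : ℝ) ^ K * (64 : ℝ) ^ r * (Real.exp (-2) ^ K * Real.exp (-63) ^ r) =
      ((3 : ℝ) * Real.exp (-2)) ^ K * ((64 : ℝ) * Real.exp (-63)) ^ r := by
    rw [mul_pow, mul_pow]; ring
  rw [e]
  exact mul_le_one₀ (pow_le_one₀ (by positivity) h3) (by positivity) (pow_le_one₀ (by positivity) h64)

/-- **The polylog-radius rung, modulo its two inputs.** -/
theorem ringLinFormsLocalPolyLt3_of (hT : TwistBoundX3LocalQ) (hW : RingWindowLocalPolyLt3) :
    RingLinFormsLocalPolyLt3 := by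
  classical
  obtain ⟨θ₀, hθ₀, HW⟩ := hW
  obtain ⟨A, c, hA, hc, hAt⟩ := twistQ_params hT
  set ε : ℝ := (1 - θ₀) / 2 with hε
  have hεpos : 0 < ε := by rw [hε]; linarith
  refine ⟨θ₀ + ε, by rw [hε]; linarith, fun C => ?_⟩
  -- `m` with `A e^{−m} ≤ ε/4`
  obtain ⟨m, hm⟩ : ∃ m : ℕ, A * Real.exp (-(m : ℝ)) ≤ ε / 4 := by
    obtain ⟨k, hk⟩ := exists_pow_lt_of_lt_one (show 0 < (ε / 4) / (A + 1) by positivity)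
      (Real.exp_lt_one_iff.2 (show (-1 : ℝ) < 0 by norm_num))
    refine ⟨k, ?_⟩
    have hA1 : 0 < A + 1 := by positivity
    have h1 := (lt_div_iff₀ hA1).1 hk
    have e : Real.exp (-(k : ℝ)) = Real.exp (-1) ^ k := by rw [← Real.exp_nat_mul]; ring_nf
    rw [e]
    have h2 : A * Real.exp (-1) ^ k ≤ (A + 1) * Real.exp (-1) ^ k :=
      mul_le_mul_of_nonneg_right (by linarith) (pow_nonneg (Real.exp_pos _).le k)
    rw [mul_comm] at h1
    linarith
  -- `T_c` with `c·T_c ≥ 65 + m`; junta-size constant `W_b`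
  set Tc : ℕ := ⌈((65 : ℝ) + m) / c⌉₊ with hTc
  have hTc' : (65 : ℝ) + m ≤ c * Tc := by
    have h1 : ((65 : ℝ) + m) / c ≤ Tc := Nat.le_ceil _
    rwa [div_le_iff₀ hc, mul_comm] at h1
  set Wb : ℕ := 4 + 81 * Tc with hWb
  -- large `N`
  obtain ⟨nW, hnW⟩ := HW (C * 5 + 1)
  obtain ⟨n₁, hn₁⟩ := const_mul_logPow_le (2 * (Wb + 1)) (C * 5)
  refine ⟨max (max nW n₁) (max (2 ^ (2 * (Wb + 1))) 4), fun N hN r hr K hK lam tab hloc => ?_⟩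
  have hNW : nW ≤ N := le_trans (le_trans (le_max_left _ _) (le_max_left _ _)) hN
  have hNn₁ : n₁ ≤ N := le_trans (le_trans (le_max_right _ _) (le_max_left _ _)) hN
  have hN4 : 4 ≤ N := le_trans (le_trans (le_max_right _ _) (le_max_right _ _)) hN
  set k := Nat.log 2 N with hk
  have hkWb : 2 * (Wb + 1) ≤ k :=
    Nat.le_log_of_pow_le one_lt_two (le_trans (le_trans (le_max_left _ _) (le_max_right _ _)) hN)
  have hk2 : 2 ≤ k := Nat.le_log_of_pow_le (by norm_num) hN4
  set X := k ^ C with hX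
  have hX1 : 1 ≤ X := Nat.one_le_pow _ _ (by omega)
  -- the spread threshold
  set T : ℕ := Tc * (K + r + 1) with hTdef
  set w : ℕ := 4 * r + (2 * r + 1) ^ 3 * T + 1 with hw
  have hw1 : w - 1 = 4 * r + (2 * r + 1) ^ 3 * T := by rw [hw]; omega
  -- junta
  obtain ⟨J, hJcard, hgen⟩ := LinForms.card_le_junta_add_twist (p := 3) lam w
  set P : (Fin K → ZMod 3) → (Fin N → Bool) → Prop := fun v x =>
    OddZeros x ∧ RingHLF.Rel x (fun k => xor (tGuess x k) (tab k v x)) with hP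
  set Bv : ℝ := A * (64 : ℝ) ^ r * Real.exp (-(c * T)) * (2 : ℝ) ^ N with hBv
  have hBv0 : 0 ≤ Bv := by positivity
  -- `|J| + 1 ≤ Y = (W_b + 1)·X^5`
  set Y : ℕ := (Wb + 1) * X ^ 5 with hY
  have hJY : J.card + 1 ≤ Y := by
    have hT3 : T ≤ 3 * Tc * X := by
      calc T = Tc * (K + r + 1) := rfl
        _ ≤ Tc * (X + X + X) := Nat.mul_le_mul_left _ (by omega)
        _ = 3 * Tc * X := by ring
    have hR : (2 * r + 1) ^ 3 ≤ 27 * X ^ 3 := by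
      calc (2 * r + 1) ^ 3 ≤ (3 * X) ^ 3 := Nat.pow_le_pow_left (by omega) 3
        _ = 27 * X ^ 3 := by ring
    have hXX : X ≤ X ^ 4 := by
      calc X = X ^ 1 := (pow_one X).symm
        _ ≤ X ^ 4 := Nat.pow_le_pow_right hX1 (by norm_num)
    have hw' : w - 1 ≤ Wb * X ^ 4 := by
      rw [hw1]
      calc 4 * r + (2 * r + 1) ^ 3 * T ≤ 4 * X + 27 * X ^ 3 * (3 * Tc * X) :=
            add_le_add (Nat.mul_le_mul_left _ hr) (Nat.mul_le_mul hR hT3)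
        _ ≤ 4 * X ^ 4 + 27 * X ^ 3 * (3 * Tc * X) := by omega
        _ = Wb * X ^ 4 := by rw [hWb]; ring
    have hJ : J.card ≤ Wb * X ^ 5 := by
      calc J.card ≤ K * (w - 1) := hJcard
        _ ≤ X * (Wb * X ^ 4) := Nat.mul_le_mul hK hw'
        _ = Wb * X ^ 5 := by ring
    have : 1 ≤ X ^ 5 := Nat.one_le_pow _ _ hX1
    rw [hY]; nlinarith
  have hYpos : 0 < Y := by omega
  -- the window length `L = N / Y` and the room
  set L : ℕ := N / Y with hL
  have hX5 : X ^ 5 = k ^ (C * 5) := by rw [hX, ← pow_mul]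
  have hNY : 2 * Y ≤ N := by
    have h1 := hn₁ N hNn₁
    rw [← hk, ← hX5] at h1
    have : 2 * Y = 2 * (Wb + 1) * X ^ 5 := by rw [hY]; ring
    omega
  have hL1 : 1 ≤ L := by
    rw [hL, Nat.le_div_iff_mul_le hYpos]; omega
  have hLY : L * Y ≤ N := Nat.div_mul_le_self N Y
  have hN2LY : N ≤ 2 * (L * Y) := by
    have h1 : N < N / Y * Y + Y := Nat.lt_div_mul_add hYpos
    have h2 : Y ≤ L * Y := Nat.le_mul_of_pos_left Y hL1
    rw [← hL] at h1
    omega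
  have hNL : N ≤ L * k ^ (C * 5 + 1) := by
    calc N ≤ 2 * (L * Y) := hN2LY
      _ = L * (2 * (Wb + 1)) * X ^ 5 := by rw [hY]; ring
      _ ≤ L * k * X ^ 5 := Nat.mul_le_mul_right _ (Nat.mul_le_mul_left _ hkWb)
      _ = L * k ^ (C * 5 + 1) := by rw [hX5, pow_succ]; ring
  have hrC : r ≤ k ^ (C * 5 + 1) :=
    hr.trans (Nat.pow_le_pow_right (by omega) (by omega))
  -- the junta-free window `[L j, L j + L)`
  obtain ⟨j, hj, hjJ⟩ := TransferWalk.exists_window_disjoint_len L J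
  have hfit : L * j + L ≤ N := by
    have : L * j + L ≤ L * Y := by
      rw [← Nat.mul_succ]; exact Nat.mul_le_mul_left _ (by omega)
    omega
  -- hypothesis (a): junta-selected local tables on the free window
  have ha : ∀ t : Fin K → ZMod 3, ((univ.filter fun x : Fin N → Bool =>
      P (fun j => (∑ i ∈ J, if x i then lam j i else 0) + t j) x).card : ℝ) ≤ θ₀ * (2 : ℝ) ^ (N - 1) := by
    intro t
    set rule : Fin N → (Fin N → Bool) → Bool :=
      fun k x => tab k (fun j => (∑ i ∈ J, if x i then lam j i else 0) + t j) x with hrule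
    have hmeas : ∀ (x x' : Fin N → Bool) (k : Fin N),
        (∀ j' : Fin N, (j'.val < L * j ∨ L * j + L ≤ j'.val) ∨ CycNear N r j' k → x j' = x' j') →
          rule k x = rule k x' := by
      intro x x' k hxx
      have hJeq : (fun jj => (∑ i ∈ J, if x i then lam jj i else 0) + t jj) =
          (fun jj => (∑ i ∈ J, if x' i then lam jj i else 0) + t jj) := by
        funext jj
        rw [sum_congr rfl fun i hi => by rw [hxx i (Or.inl (hjJ i hi))]]
      simp only [hrule, hJeq]
      exact hloc _ x x' k fun j' hj' => hxx j' (Or.inr hj')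
    have h := hnW N hNW r hrC (L * j) L hNL hfit rule hmeas
    refine le_trans (le_of_eq ?_) h
    congr 2
  -- hypothesis (b): the quantitative block twist bound beyond the spread threshold
  have hb : ∀ (v : Fin K → ZMod 3) (β : Fin N → ZMod 3), w ≤ (univ.filter fun i => β i ≠ 0).card →
      ‖∑ x : Fin N → Bool, (ZMod.stdAddChar (∑ i, if x i then β i else 0) : ℂ) * (if P v x then (1 : ℂ) else 0)‖
        ≤ Bv := by
    intro v β hβ
    exact hAt r T N (fun k x => tab k v x) (hloc v) β (by omega)
  have hmain := hgen P (θ₀ * (2 : ℝ) ^ (N - 1)) Bv hBv0 ha hb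
  have hres : ∀ x : Fin N → Bool, LinForms.resVec lam x = fun j => ∑ i, if x i then lam j i else 0 := fun x => rfl
  have hset : (univ.filter fun x : Fin N → Bool =>
      OddZeros x ∧ RingHLF.Rel x (fun k => xor (tGuess x k) (tab k (LinForms.resVec lam x) x))) =
      univ.filter fun x : Fin N → Bool => P (fun j => ∑ i, if x i then lam j i else 0) x :=
    filter_congr fun x _ => by simp only [hP, hres]
  rw [hset]
  refine le_trans hmain ?_
  -- error term `3^K · Bv ≤ (ε/2)·2^{N-1}`
  have herr : (3 : ℝ) ^ K * Bv ≤ (ε / 2) * (2 : ℝ) ^ (N - 1) := by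
    -- `c·T ≥ 2K + 63r + m`
    have hcT : (2 * K + 63 * r + m : ℝ) ≤ c * T := by
      have h1 : (T : ℝ) = Tc * ((K : ℝ) + r + 1) := by rw [hTdef]; push_cast; ring
      have h2 : ((65 : ℝ) + m) * ((K : ℝ) + r + 1) ≤ c * Tc * ((K : ℝ) + r + 1) :=
        mul_le_mul_of_nonneg_right hTc' (by positivity)
      have h3 : (2 * K + 63 * r + m : ℝ) ≤ ((65 : ℝ) + m) * ((K : ℝ) + r + 1) := by
        have : (0 : ℝ) ≤ K := Nat.cast_nonneg K
        have : (0 : ℝ) ≤ r := Nat.cast_nonneg r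
        have : (0 : ℝ) ≤ m := Nat.cast_nonneg m
        nlinarith
      rw [h1, ← mul_assoc]
      linarith
    have hexp : Real.exp (-(c * T)) ≤ Real.exp (-2) ^ K * Real.exp (-63) ^ r * Real.exp (-(m : ℝ)) := by
      have e : Real.exp (-2) ^ K * Real.exp (-63) ^ r * Real.exp (-(m : ℝ)) =
          Real.exp (-(2 * K + 63 * r + m : ℝ)) := by
        rw [← Real.exp_nat_mul, ← Real.exp_nat_mul, ← Real.exp_add, ← Real.exp_add]
        congr 1; ring
      rw [e, Real.exp_le_exp]
      linarith
    have hN2 : (2 : ℝ) ^ N = 2 * (2 : ℝ) ^ (N - 1) := by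
      rw [← pow_succ']; congr 1; omega
    have h2N : (0 : ℝ) ≤ (2 : ℝ) ^ N := by positivity
    calc (3 : ℝ) ^ K * Bv = (3 : ℝ) ^ K * (64 : ℝ) ^ r * Real.exp (-(c * T)) * (A * (2 : ℝ) ^ N) := by
          rw [hBv]; ring
      _ ≤ (3 : ℝ) ^ K * (64 : ℝ) ^ r * (Real.exp (-2) ^ K * Real.exp (-63) ^ r * Real.exp (-(m : ℝ))) *
            (A * (2 : ℝ) ^ N) := by gcongr
      _ = ((3 : ℝ) ^ K * (64 : ℝ) ^ r * (Real.exp (-2) ^ K * Real.exp (-63) ^ r)) *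
            (A * Real.exp (-(m : ℝ))) * (2 : ℝ) ^ N := by ring
      _ ≤ 1 * (ε / 4) * (2 : ℝ) ^ N := by
          have hy0 : 0 ≤ A * Real.exp (-(m : ℝ)) := mul_nonneg hA (Real.exp_pos _).le
          exact mul_le_mul_of_nonneg_right (mul_le_mul (three_pow_mul_exp_le K r) hm hy0 zero_le_one) h2N
      _ = (ε / 2) * (2 : ℝ) ^ (N - 1) := by rw [hN2]; ring
  have h3cast : ((3 : ℕ) : ℝ) = (3 : ℝ) := by norm_num
  rw [h3cast]
  have h2N : (0 : ℝ) ≤ (2 : ℝ) ^ (N - 1) := by positivity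
  have hε2 : 0 ≤ ε * (2 : ℝ) ^ (N - 1) := mul_nonneg hεpos.le h2N
  linarith

/-- **`ringLinFormsLocalPolyLt3 : RingLinFormsLocalPolyLt3` — the polylog-radius rung R-lin3 ⊗ R-loc, PROVED.** -/
theorem ringLinFormsLocalPolyLt3 : RingLinFormsLocalPolyLt3 :=
  ringLinFormsLocalPolyLt3_of twistBoundX3LocalQ ringWindowLocalPolyLt3

end BondTwist3

end Summit.QuantumAdvantage.AdviceFreeQNC0

end
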